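import Mathlib
import HarnessLib
import Summits.ValiantsHypothesis.ValiantsHypothesis.Theorems.LacunarySymmetroidMatrixDescartesProductPlusOneOneBump
import Summits.ValiantsHypothesis.ValiantsHypothesis.Theorems.LacunarySymmetroidMatrixDescartesProductPlusOneSlopeMixedLine

/-!
# LINE (A) `product_plus_one` — THE MIXED-RATE ONE-BUMP CELL in LINE currency (K = 3): one bump row against any company of
# background rows carries at most TWO zeros of `W(∏ fewnomial)` per window, at most THREE of `eulerNumerator d a l₀` for every coupling

Crux item stmt-ValiantsHypothesis-18050; owner memo §21.2 `MixedRateOneBumpCellK3` (owner p7 g17), proved here on the tower laws of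
✓/⧗ `…ProductPlusOneOneBump` (`background_law` = the W∘W identity, ✓ `slope_logConcave_of_sign`, ✓ engine `slope_no_three_zeros_of_pull`).
Support `d 1 = d 0 + e₁ + 1`, `d 2 = d 1 + e₂ + 1`, window `[u, v] ⊂ (0,∞)`, rows `f_j = Σ_l C (a j l) X^{d l}` (= `fewnomial d (a j)`).

THE MENU (the owner's, verbatim up to currency).  BUMP row `j₀` — one of: a one-signed binomial on the pair (0,1) (`a₂ = 0 < a₀a₁`), on (1,2)
(`a₀ = 0 < a₁a₂`) or on (0,2) (`a₁ = 0 < a₀a₂`) [knees of rates p, q−p, q]; a switched incoherent trinomial (`a₀ > 0 > a₁, a₂`, `f(u) < 0`);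
an unswitched coherent trinomial (`a₀, a₁ > 0 > a₂`, `f(v) > 0`).  BACKGROUND rows `j ≠ j₀` — each one of: a one-change binomial on any pair
(`a₂ = 0`, `a₀a₁ < 0` / `a₀ = 0`, `a₁a₂ < 0` / `a₁ = 0`, `a₀a₂ < 0`) with its root OUTSIDE the window (`0 < f(u)·f(v)`) [poles of rates p, q−p, q on
either side]; an unswitched incoherent trinomial-or-binomial (`a₀ > 0`, `a₁, a₂ ≤ 0`, `a₁ + a₂ < 0`, `f(v) > 0`); a switched coherent trinomial
(`a₀, a₁ > 0 > a₂`, `f(u) < 0`).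

* ★★ `oneBump_company_wronskian_no_three_zeros` — `W(∏ f_j)` does not vanish at three points of the window (tools ✓ `binomial_sign_const`,
  ✓ `coherent_rowPsi1_neg_of_lt`, ✓ `riser_turning_persist`, ✓ `coherent_value_pos_of_le` / `…neg_of_ge`); the counts (≤ 2 roots of W, ≤ 3 of
  `eulerNumerator` every coupling) are `…ProductPlusOneOneBumpCount`.
First W-cell whose background mixes ALL THREE RATES (binomial poles on the three pairs at once) with the incoherent cloud and switched coherent rows;
subsumes the counting step of ✓ `…SlopeLine`, ✓ `…SlopeKneeLine`, ✓ `…SlopeCoherent`, ✓ `…SlopeMixedLine`, ⧗ `…PoleCloudLine`.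
HONEST FRAMING: ONE bump (two bumps need the magnitude law, memo §21.3); nothing here proves `WronskianBudgetK3` / `OneChangeFloorK3` / the stubs /
18050 / `MatrixDescartes`; `VP ≠ VNP` is NOT proved.  No definitions, no named facts.
-/

set_option linter.dupNamespace false

namespace Summit.ValiantsHypothesis.ValiantsHypothesis.Theorems.LacunarySymmetroidMatrixDescartes

namespace ProductPlusOne

open Finset Polynomial
open scoped BigOperators Polynomial

/-! ### §2 The cell -/

/-- ★★ **THE MIXED-RATE ONE-BUMP CELL: no three zeros** (LINE currency; menu in the module docstring).  On a window `[u,v] ⊂ (0,∞)` with one bump row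
`j₀` and every other row a background row, `W(∏_j f_j)` does not vanish at three points `u ≤ x₁ < x₂ < x₃ ≤ v`. [this file's theorem] -/
theorem oneBump_company_wronskian_no_three_zeros {m : ℕ} (d : Fin 3 → ℕ) (e₁ e₂ : ℕ)
    (he₁ : d 1 = d 0 + e₁ + 1) (he₂ : d 2 = d 1 + e₂ + 1) (a : Fin m → Fin 3 → ℝ) (j₀ : Fin m) {u v : ℝ} (hu : 0 < u)
    (hbump : (a j₀ 2 = 0 ∧ 0 < a j₀ 0 * a j₀ 1) ∨ (a j₀ 0 = 0 ∧ 0 < a j₀ 1 * a j₀ 2) ∨ (a j₀ 1 = 0 ∧ 0 < a j₀ 0 * a j₀ 2) ∨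
      (0 < a j₀ 0 ∧ a j₀ 1 < 0 ∧ a j₀ 2 < 0 ∧ (∑ l, C (a j₀ l) * X ^ (d l) : ℝ[X]).eval u < 0) ∨
      (0 < a j₀ 0 ∧ 0 < a j₀ 1 ∧ a j₀ 2 < 0 ∧ 0 < (∑ l, C (a j₀ l) * X ^ (d l) : ℝ[X]).eval v))
    (hbg : ∀ j, j ≠ j₀ →
      (((a j 2 = 0 ∧ a j 0 * a j 1 < 0) ∨ (a j 0 = 0 ∧ a j 1 * a j 2 < 0) ∨ (a j 1 = 0 ∧ a j 0 * a j 2 < 0)) ∧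
          0 < (∑ l, C (a j l) * X ^ (d l) : ℝ[X]).eval u * (∑ l, C (a j l) * X ^ (d l) : ℝ[X]).eval v) ∨
      (0 < a j 0 ∧ a j 1 ≤ 0 ∧ a j 2 ≤ 0 ∧ a j 1 + a j 2 < 0 ∧ 0 < (∑ l, C (a j l) * X ^ (d l) : ℝ[X]).eval v) ∨
      (0 < a j 0 ∧ 0 < a j 1 ∧ a j 2 < 0 ∧ (∑ l, C (a j l) * X ^ (d l) : ℝ[X]).eval u < 0))
    {x₁ x₂ x₃ : ℝ} (hx₁ : u ≤ x₁) (h12 : x₁ < x₂) (h23 : x₂ < x₃) (hx₃ : x₃ ≤ v)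
    (hzero : ∀ x ∈ ({x₁, x₂, x₃} : Set ℝ),
      ((∏ j, ∑ l, C (a j l) * X ^ (d l) : ℝ[X]) * (X * derivative (X * derivative (∏ j, ∑ l, C (a j l) * X ^ (d l) : ℝ[X])))
        - (X * derivative (∏ j, ∑ l, C (a j l) * X ^ (d l) : ℝ[X])) ^ 2).eval x = 0) : False := by
  classical
  have hd := fin3_support_eq_gaps d e₁ e₂ he₁ he₂
  have hev : ∀ j x, (∑ l, C (a j l) * X ^ (d l) : ℝ[X]).eval x
        = x ^ (d 0) * (a j 0 - (-(a j 1)) * x ^ (e₁ + 1) - (-(a j 2)) * x ^ (e₁ + e₂ + 2)) := by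
    intro j x
    have h := (eval_trinomial_three (d 0) (e₁ + 1) (e₁ + e₂ + 2) (a j) x).1
    rw [hd] at h; rw [h]; ring
  have hv : u ≤ v := hx₁.trans (h12.le.trans (h23.le.trans hx₃))
  have hv0 : 0 < v := hu.trans_le hv
  have hx0 : ∀ x ∈ Set.Icc u v, 0 < x := fun x hx => hu.trans_le hx.1
  have hI : ∀ x ∈ Set.Icc x₁ x₃, x ∈ Set.Icc u v := fun x hx => ⟨hx₁.trans hx.1, hx.2.trans hx₃⟩
  have h0 : 0 < x₁ := hu.trans_le hx₁
  have incoh_neg : ∀ (A' B' C' : ℝ), 0 ≤ B' → 0 ≤ C' → ∀ (y₀ y : ℝ), 0 < y₀ → y₀ ≤ y →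
      A' - B' * y₀ ^ (e₁ + 1) - C' * y₀ ^ (e₁ + e₂ + 2) < 0 → A' - B' * y ^ (e₁ + 1) - C' * y ^ (e₁ + e₂ + 2) < 0 := by
    intro A' B' C' hB' hC' y₀ y hy₀ hle h
    have hm1 : B' * y₀ ^ (e₁ + 1) ≤ B' * y ^ (e₁ + 1) := mul_le_mul_of_nonneg_left (pow_le_pow_left₀ hy₀.le hle _) hB'
    have hm2 : C' * y₀ ^ (e₁ + e₂ + 2) ≤ C' * y ^ (e₁ + e₂ + 2) := mul_le_mul_of_nonneg_left (pow_le_pow_left₀ hy₀.le hle _) hC'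
    linarith
  -- normal-form value and its sign from the LINE value (`f = x^{d 0} · F`)
  have hFsign : ∀ j x, 0 < x → ∀ s : ℝ, (∑ l, C (a j l) * X ^ (d l) : ℝ[X]).eval x * s
      = x ^ (d 0) * ((a j 0 - (-(a j 1)) * x ^ (e₁ + 1) - (-(a j 2)) * x ^ (e₁ + e₂ + 2)) * s) := by
    intro j x _ s; rw [hev]; ring
  have hneg_of : ∀ j x, 0 < x → (∑ l, C (a j l) * X ^ (d l) : ℝ[X]).eval x < 0 →
      a j 0 - (-(a j 1)) * x ^ (e₁ + 1) - (-(a j 2)) * x ^ (e₁ + e₂ + 2) < 0 := by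
    intro j x hx h
    rw [hev] at h
    exact ((mul_neg_iff.1 h).resolve_right (fun h' => absurd (pow_pos hx _) (not_lt.2 h'.1.le))).2
  have hpos_of : ∀ j x, 0 < x → 0 < (∑ l, C (a j l) * X ^ (d l) : ℝ[X]).eval x →
      0 < a j 0 - (-(a j 1)) * x ^ (e₁ + 1) - (-(a j 2)) * x ^ (e₁ + e₂ + 2) := by
    intro j x hx h
    rw [hev] at h
    exact (mul_pos_iff_of_pos_left (pow_pos hx _)).1 h
  -- BACKGROUND rows: pointwise law on the whole window
  have hBG : ∀ x ∈ Set.Icc u v, ∀ j ∈ Finset.univ.erase j₀,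
      a j 0 - (-(a j 1)) * x ^ (e₁ + 1) - (-(a j 2)) * x ^ (e₁ + e₂ + 2) ≠ 0 ∧
      0 < rowPsi1 e₁ e₂ (a j 0) (-(a j 1)) (-(a j 2)) x ∧
      0 ≤ (-(a j 1) * x ^ (e₁ + 1)) * (-(a j 2) * x ^ (e₁ + e₂ + 2)) * (a j 0 * rowU e₁ e₂ (a j 0) (-(a j 1)) (-(a j 2)) x) := by
    intro x hx j hj
    have hx' := hx0 x hx
    have hj' := Finset.ne_of_mem_erase hj
    rcases hbg j hj' with ⟨hbin, hprod⟩ | ⟨hA, h1, h2, h12', hunv⟩ | ⟨hA, h1, h2, hswu⟩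
    · -- one-change binomials: root outside the window
      rcases hbin with ⟨h2z, h01⟩ | ⟨h0z, h12z⟩ | ⟨h1z, h02⟩
      · -- pair (0,1): `f = x^{d0}(a₀ + a₁ x^p)`
        have hg : ∀ y, 0 < y → (∑ l, C (a j l) * X ^ (d l) : ℝ[X]).eval y = y ^ (d 0) * (a j 0 + a j 1 * y ^ (e₁ + 1)) := by
          intro y _; rw [hev, h2z]; ring
        have hprod' : 0 < (a j 0 + a j 1 * u ^ (e₁ + 1)) * (a j 0 + a j 1 * v ^ (e₁ + 1)) := by
          rw [hg u hu, hg v (hu.trans_le hv)] at hprod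
          have : u ^ d 0 * (a j 0 + a j 1 * u ^ (e₁ + 1)) * (v ^ d 0 * (a j 0 + a j 1 * v ^ (e₁ + 1)))
              = (u ^ d 0 * v ^ d 0) * ((a j 0 + a j 1 * u ^ (e₁ + 1)) * (a j 0 + a j 1 * v ^ (e₁ + 1))) := by ring
          rw [this] at hprod
          exact (mul_pos_iff_of_pos_left (by positivity)).1 hprod
        have hgx := binomial_sign_const (a j 0) (a j 1) (e₁ + 1) hu hprod' hx
        have hFx : a j 0 - (-(a j 1)) * x ^ (e₁ + 1) ≠ 0 := by
          intro h
          have : a j 0 + a j 1 * x ^ (e₁ + 1) = 0 := by linarith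
          rw [this, mul_zero] at hgx; exact lt_irrefl 0 hgx
        have hAB : 0 < a j 0 * -(a j 1) := by nlinarith
        refine ⟨by rw [h2z]; simpa using hFx, ?_, ?_⟩
        · rw [h2z, neg_zero]; exact pair01_pole_rowPsi1_pos e₁ e₂ (a j 0) (-(a j 1)) hx' hAB hFx
        · rw [h2z]; simp
      · -- pair (1,2): `f = x^{d0+p}(a₁ + a₂ x^{q−p})`
        have hg : ∀ y, 0 < y → (∑ l, C (a j l) * X ^ (d l) : ℝ[X]).eval y
            = y ^ (d 0) * y ^ (e₁ + 1) * (a j 1 + a j 2 * y ^ (e₂ + 1)) := by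
          intro y _; rw [hev, h0z]; ring
        have hprod' : 0 < (a j 1 + a j 2 * u ^ (e₂ + 1)) * (a j 1 + a j 2 * v ^ (e₂ + 1)) := by
          rw [hg u hu, hg v (hu.trans_le hv)] at hprod
          have : u ^ d 0 * u ^ (e₁ + 1) * (a j 1 + a j 2 * u ^ (e₂ + 1)) * (v ^ d 0 * v ^ (e₁ + 1) * (a j 1 + a j 2 * v ^ (e₂ + 1)))
              = (u ^ d 0 * u ^ (e₁ + 1) * (v ^ d 0 * v ^ (e₁ + 1)))
                * ((a j 1 + a j 2 * u ^ (e₂ + 1)) * (a j 1 + a j 2 * v ^ (e₂ + 1))) := by ring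
          rw [this] at hprod
          exact (mul_pos_iff_of_pos_left (by positivity)).1 hprod
        have hgx := binomial_sign_const (a j 1) (a j 2) (e₂ + 1) hu hprod' hx
        have hFx : (0 : ℝ) - (-(a j 1)) * x ^ (e₁ + 1) - (-(a j 2)) * x ^ (e₁ + e₂ + 2) ≠ 0 := by
          intro h
          have : x ^ (e₁ + 1) * (a j 1 + a j 2 * x ^ (e₂ + 1)) = 0 := by
            have : (0 : ℝ) - (-(a j 1)) * x ^ (e₁ + 1) - (-(a j 2)) * x ^ (e₁ + e₂ + 2)
                = x ^ (e₁ + 1) * (a j 1 + a j 2 * x ^ (e₂ + 1)) := by ring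
            rw [← this]; exact h
          rcases mul_eq_zero.1 this with h' | h'
          · exact absurd h' (pow_ne_zero _ hx'.ne')
          · rw [h', mul_zero] at hgx; exact lt_irrefl 0 hgx
        have hBC : -(a j 1) * -(a j 2) < 0 := by rw [neg_mul_neg]; exact h12z
        refine ⟨by rw [h0z]; exact hFx, ?_, ?_⟩
        · rw [h0z]; exact pair12_pole_rowPsi1_pos e₁ e₂ (-(a j 1)) (-(a j 2)) hx' hBC hFx
        · rw [h0z]; simp
      · -- pair (0,2): `f = x^{d0}(a₀ + a₂ x^q)`
        have hg : ∀ y, 0 < y → (∑ l, C (a j l) * X ^ (d l) : ℝ[X]).eval y = y ^ (d 0) * (a j 0 + a j 2 * y ^ (e₁ + e₂ + 2)) := by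
          intro y _; rw [hev, h1z]; ring
        have hprod' : 0 < (a j 0 + a j 2 * u ^ (e₁ + e₂ + 2)) * (a j 0 + a j 2 * v ^ (e₁ + e₂ + 2)) := by
          rw [hg u hu, hg v (hu.trans_le hv)] at hprod
          have : u ^ d 0 * (a j 0 + a j 2 * u ^ (e₁ + e₂ + 2)) * (v ^ d 0 * (a j 0 + a j 2 * v ^ (e₁ + e₂ + 2)))
              = (u ^ d 0 * v ^ d 0) * ((a j 0 + a j 2 * u ^ (e₁ + e₂ + 2)) * (a j 0 + a j 2 * v ^ (e₁ + e₂ + 2))) := by ring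
          rw [this] at hprod
          exact (mul_pos_iff_of_pos_left (by positivity)).1 hprod
        have hgx := binomial_sign_const (a j 0) (a j 2) (e₁ + e₂ + 2) hu hprod' hx
        have hFx : a j 0 - (-(a j 2)) * x ^ (e₁ + e₂ + 2) ≠ 0 := by
          intro h
          have : a j 0 + a j 2 * x ^ (e₁ + e₂ + 2) = 0 := by linarith
          rw [this, mul_zero] at hgx; exact lt_irrefl 0 hgx
        have hAC : 0 < a j 0 * -(a j 2) := by nlinarith
        refine ⟨by rw [h1z]; simpa using hFx, ?_, ?_⟩
        · rw [h1z, neg_zero]; exact pair02_pole_rowPsi1_pos e₁ e₂ (a j 0) (-(a j 2)) hx' hAC hFx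
        · rw [h1z]; simp
    · -- unswitched incoherent row (positive at `v`, hence on the window)
      have h3 := hpos_of j v (hu.trans_le hv) hunv
      have hm1 : a j 1 * v ^ (e₁ + 1) ≤ a j 1 * x ^ (e₁ + 1) := mul_le_mul_of_nonpos_left (pow_le_pow_left₀ hx'.le hx.2 _) h1
      have hm2 : a j 2 * v ^ (e₁ + e₂ + 2) ≤ a j 2 * x ^ (e₁ + e₂ + 2) := mul_le_mul_of_nonpos_left (pow_le_pow_left₀ hx'.le hx.2 _) h2
      have hF : 0 < a j 0 - (-(a j 1)) * x ^ (e₁ + 1) - (-(a j 2)) * x ^ (e₁ + e₂ + 2) := by linarith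
      have hu' := rowU_pos e₁ e₂ (a j 0) (-(a j 1)) (-(a j 2)) hF
      refine ⟨hF.ne', (rowPsi_signs e₁ e₂ (a j 0) (-(a j 1)) (-(a j 2)) hx' (by linarith) (by linarith) (by linarith) hF).2.1, ?_⟩
      have hβ : 0 ≤ -(a j 1) * x ^ (e₁ + 1) := mul_nonneg (by linarith) (pow_pos hx' _).le
      have hγ : 0 ≤ -(a j 2) * x ^ (e₁ + e₂ + 2) := mul_nonneg (by linarith) (pow_pos hx' _).le
      have hAu : 0 ≤ a j 0 * rowU e₁ e₂ (a j 0) (-(a j 1)) (-(a j 2)) x := by positivity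
      exact mul_nonneg (mul_nonneg hβ hγ) hAu
    · -- switched coherent row (negative at `u`, hence on the window)
      have h1' := hneg_of j u hu hswu
      have hF : a j 0 - (-(a j 1)) * x ^ (e₁ + 1) - (-(a j 2)) * x ^ (e₁ + e₂ + 2) < 0 :=
        coherent_value_neg_of_ge e₁ e₂ (a j 0) (-(a j 1)) (-(a j 2)) hA.le (by linarith) hu hx.1 h1'
      have hu' : rowU e₁ e₂ (a j 0) (-(a j 1)) (-(a j 2)) x < 0 := by unfold rowU; exact inv_lt_zero.2 hF
      refine ⟨hF.ne, switchedCoherent_rowPsi1_pos e₁ e₂ (a j 0) (-(a j 1)) (-(a j 2)) hx' hA (by linarith) (by linarith) hF, ?_⟩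
      have hβ : -(a j 1) * x ^ (e₁ + 1) < 0 := mul_neg_of_neg_of_pos (by linarith) (pow_pos hx' _)
      have hγ : 0 < -(a j 2) * x ^ (e₁ + e₂ + 2) := mul_pos (by linarith) (pow_pos hx' _)
      have hAu : a j 0 * rowU e₁ e₂ (a j 0) (-(a j 1)) (-(a j 2)) x < 0 := mul_neg_of_pos_of_neg hA hu'
      exact (mul_pos_of_neg_of_neg (mul_neg_of_neg_of_pos hβ hγ) hAu).le
  -- no row vanishes on the window; the bump row's normal form is nonzero and its sign term is `≤ 0`
  have hB0 : ∀ x ∈ Set.Icc u v, a j₀ 0 - (-(a j₀ 1)) * x ^ (e₁ + 1) - (-(a j₀ 2)) * x ^ (e₁ + e₂ + 2) ≠ 0 ∧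
      (-(a j₀ 1) * x ^ (e₁ + 1)) * (-(a j₀ 2) * x ^ (e₁ + e₂ + 2)) * (a j₀ 0 * rowU e₁ e₂ (a j₀ 0) (-(a j₀ 1)) (-(a j₀ 2)) x) ≤ 0 := by
    intro x hx
    have hx' := hx0 x hx
    rcases hbump with ⟨h2z, h01⟩ | ⟨h0z, h12z⟩ | ⟨h1z, h02⟩ | ⟨hA, h1, h2, hswu⟩ | ⟨hA, h1, h2, hunv⟩
    · refine ⟨?_, by rw [h2z]; simp⟩
      rw [h2z]
      have : a j₀ 0 - (-(a j₀ 1)) * x ^ (e₁ + 1) - (-0) * x ^ (e₁ + e₂ + 2) = a j₀ 0 + a j₀ 1 * x ^ (e₁ + 1) := by ring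
      rw [this]
      intro h
      have hxp : 0 < x ^ (e₁ + 1) := pow_pos hx' _
      have ha0 : a j₀ 0 = -(a j₀ 1 * x ^ (e₁ + 1)) := by linarith
      rw [ha0] at h01
      nlinarith [mul_nonneg (sq_nonneg (a j₀ 1)) hxp.le]
    · refine ⟨?_, by rw [h0z]; simp⟩
      rw [h0z]
      have : (0 : ℝ) - (-(a j₀ 1)) * x ^ (e₁ + 1) - (-(a j₀ 2)) * x ^ (e₁ + e₂ + 2) = x ^ (e₁ + 1) * (a j₀ 1 + a j₀ 2 * x ^ (e₂ + 1)) := by ring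
      rw [this]
      refine mul_ne_zero (pow_ne_zero _ hx'.ne') ?_
      intro h
      have hxp : 0 < x ^ (e₂ + 1) := pow_pos hx' _
      have ha1 : a j₀ 1 = -(a j₀ 2 * x ^ (e₂ + 1)) := by linarith
      rw [ha1] at h12z
      nlinarith [mul_nonneg (sq_nonneg (a j₀ 2)) hxp.le]
    · refine ⟨?_, by rw [h1z]; simp⟩
      rw [h1z]
      have : a j₀ 0 - (-0) * x ^ (e₁ + 1) - (-(a j₀ 2)) * x ^ (e₁ + e₂ + 2) = a j₀ 0 + a j₀ 2 * x ^ (e₁ + e₂ + 2) := by ring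
      rw [this]
      intro h
      have hxp : 0 < x ^ (e₁ + e₂ + 2) := pow_pos hx' _
      have ha0 : a j₀ 0 = -(a j₀ 2 * x ^ (e₁ + e₂ + 2)) := by linarith
      rw [ha0] at h02
      nlinarith [mul_nonneg (sq_nonneg (a j₀ 2)) hxp.le]
    · have h1' := hneg_of j₀ u hu hswu
      have hF : a j₀ 0 - (-(a j₀ 1)) * x ^ (e₁ + 1) - (-(a j₀ 2)) * x ^ (e₁ + e₂ + 2) < 0 :=
        incoh_neg (a j₀ 0) (-(a j₀ 1)) (-(a j₀ 2)) (by linarith) (by linarith) u x hu hx.1 h1'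
      have hu' : rowU e₁ e₂ (a j₀ 0) (-(a j₀ 1)) (-(a j₀ 2)) x < 0 := by unfold rowU; exact inv_lt_zero.2 hF
      refine ⟨hF.ne, ?_⟩
      have hβ : 0 < -(a j₀ 1) * x ^ (e₁ + 1) := mul_pos (by linarith) (pow_pos hx' _)
      have hγ : 0 < -(a j₀ 2) * x ^ (e₁ + e₂ + 2) := mul_pos (by linarith) (pow_pos hx' _)
      exact mul_nonpos_of_nonneg_of_nonpos (mul_pos hβ hγ).le (mul_nonpos_of_nonneg_of_nonpos hA.le hu'.le)
    · have h3 := hpos_of j₀ v (hu.trans_le hv) hunv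
      have hF : 0 < a j₀ 0 - (-(a j₀ 1)) * x ^ (e₁ + 1) - (-(a j₀ 2)) * x ^ (e₁ + e₂ + 2) :=
        coherent_value_pos_of_le e₁ e₂ (a j₀ 0) (-(a j₀ 1)) (-(a j₀ 2)) hA.le (by linarith) hx' hx.2 h3
      have hu' := rowU_pos e₁ e₂ (a j₀ 0) (-(a j₀ 1)) (-(a j₀ 2)) hF
      refine ⟨hF.ne', ?_⟩
      have hβ : -(a j₀ 1) * x ^ (e₁ + 1) < 0 := mul_neg_of_neg_of_pos (by linarith) (pow_pos hx' _)
      have hγ : 0 < -(a j₀ 2) * x ^ (e₁ + e₂ + 2) := mul_pos (by linarith) (pow_pos hx' _)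
      exact mul_nonpos_of_nonpos_of_nonneg (mul_neg_of_neg_of_pos hβ hγ).le (by positivity)
  have hf : ∀ x ∈ Set.Icc u v, ∀ j, (∑ l, C (a j l) * X ^ (d l) : ℝ[X]).eval x ≠ 0 := by
    intro x hx j
    rw [hev]
    refine mul_ne_zero (pow_ne_zero _ (hx0 x hx).ne') ?_
    by_cases hj : j = j₀
    · subst hj; exact (hB0 x hx).1
    · exact (hBG x hx j (Finset.mem_erase.2 ⟨hj, Finset.mem_univ _⟩)).1
  -- the slope-form sum vanishes at the three points
  have hzero' : ∀ x ∈ ({x₁, x₂, x₃} : Set ℝ),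
      rowPsi1 e₁ e₂ (a j₀ 0) (-(a j₀ 1)) (-(a j₀ 2)) x
        + cloudP1 e₁ e₂ (Finset.univ.erase j₀) (fun _ => (1 : ℝ)) (fun j => a j 0) (fun j => -(a j 1)) (fun j => -(a j 2)) x = 0 := by
    intro x hx
    have hxI : x ∈ Set.Icc u v := by
      simp only [Set.mem_insert_iff, Set.mem_singleton_iff] at hx
      rcases hx with h | h | h <;> (subst h; constructor <;> linarith)
    have h := hzero x hx
    rw [logWronskian_prod_eq_rowPsi1_sum d e₁ e₂ he₁ he₂ a (hx0 x hxI) (hf x hxI)] at h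
    have hP : ((∏ j, (∑ l, C (a j l) * X ^ (d l) : ℝ[X])).eval x) ≠ 0 := by
      rw [eval_prod]; exact Finset.prod_ne_zero_iff.2 fun j _ => hf x hxI j
    have hS : ∑ j, rowPsi1 e₁ e₂ (a j 0) (-(a j 1)) (-(a j 2)) x = 0 := by
      rcases mul_eq_zero.1 h with h1 | h1
      · exact absurd (neg_eq_zero.1 h1) (pow_ne_zero 2 hP)
      · exact h1
    rw [← Finset.add_sum_erase _ _ (Finset.mem_univ j₀)] at hS
    unfold cloudP1
    simpa only [one_mul] using hS
  -- the cloud is nonnegative at the three points, so the bump's slope form is `≤ 0` there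
  have hP1nonneg : ∀ x ∈ Set.Icc u v,
      0 ≤ cloudP1 e₁ e₂ (Finset.univ.erase j₀) (fun _ => (1 : ℝ)) (fun j => a j 0) (fun j => -(a j 1)) (fun j => -(a j 2)) x := by
    intro x hx
    unfold cloudP1
    exact Finset.sum_nonneg fun j hj => by rw [one_mul]; exact (hBG x hx j hj).2.1.le
  have hψle : ∀ x ∈ ({x₁, x₂, x₃} : Set ℝ), x ∈ Set.Icc u v → rowPsi1 e₁ e₂ (a j₀ 0) (-(a j₀ 1)) (-(a j₀ 2)) x ≤ 0 := by
    intro x hx hxI; linarith [hzero' x hx, hP1nonneg x hxI]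
  have hI1 : x₁ ∈ Set.Icc u v := ⟨hx₁, h12.le.trans (h23.le.trans hx₃)⟩
  have hI3 : x₃ ∈ Set.Icc u v := ⟨hx₁.trans (h12.le.trans h23.le), hx₃⟩
  -- the bump's slope form is `< 0` on `[x₁, x₃]`
  have hpost : ∀ x ∈ Set.Icc x₁ x₃, rowPsi1 e₁ e₂ (a j₀ 0) (-(a j₀ 1)) (-(a j₀ 2)) x < 0 := by
    intro x hx
    have hxI := hI x hx
    have hx' := hx0 x hxI
    rcases hbump with ⟨h2z, h01⟩ | ⟨h0z, h12z⟩ | ⟨h1z, h02⟩ | ⟨hA, h1, h2, hswu⟩ | ⟨hA, h1, h2, hunv⟩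
    · rw [h2z, neg_zero]; exact pair01_knee_rowPsi1_neg e₁ e₂ (a j₀ 0) (-(a j₀ 1)) hx' (by nlinarith)
    · rw [h0z]; exact pair12_knee_rowPsi1_neg e₁ e₂ (-(a j₀ 1)) (-(a j₀ 2)) hx' (by nlinarith)
    · rw [h1z, neg_zero]; exact knee_rowPsi1_neg e₁ e₂ (a j₀ 0) (-(a j₀ 2)) hx' (by nlinarith)
    · -- switched riser: at or past its turning point at `x₁`, hence rising on `(x₁, x₃]`
      have h1' := hneg_of j₀ u hu hswu
      have hsw : ∀ t ∈ Set.Icc x₁ x₃, a j₀ 0 - (-(a j₀ 1)) * t ^ (e₁ + 1) - (-(a j₀ 2)) * t ^ (e₁ + e₂ + 2) < 0 := fun t ht =>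
        incoh_neg (a j₀ 0) (-(a j₀ 1)) (-(a j₀ 2)) (by linarith) (by linarith) u t hu (hI t ht).1 h1'
      have hstart := hψle x₁ (by simp) hI1
      rcases eq_or_lt_of_le hx.1 with h | h
      · -- at `x₁` itself: `ψ₁(x₁) ≤ 0`, and `= 0` would make the cloud vanish there
        subst h
        rcases lt_or_eq_of_le hstart with hlt | heq
        · exact hlt
        · exfalso
          -- then `ψ₁ < 0` just right of `x₁`... use the midpoint with `x₂`: persistence gives `ψ₁ < 0` on `(x₁, x₃]`, and at `x₂`
          -- the cloud value equals `−ψ₁(x₂) > 0`; but we need a contradiction at `x₁`: cloud(x₁) = −ψ₁(x₁) = 0 forces every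
          -- background term to vanish, contradicting positivity unless the cloud is empty — in which case `ψ₁(x₂) = 0` too.
          have hcl := hzero' x₁ (by simp)
          rw [heq, zero_add] at hcl
          rcases (Finset.univ.erase j₀).eq_empty_or_nonempty with hs | hs
          · have h2 := hzero' x₂ (by simp)
            rw [hs] at h2
            simp only [cloudP1, Finset.sum_empty, add_zero] at h2
            have hper := riser_turning_persist e₁ e₂ (a j₀ 0) (-(a j₀ 1)) (-(a j₀ 2)) (by linarith) (by linarith) h0
              (h12.trans h23).le hsw heq.le x₂ ⟨h12, h23.le⟩
            exact absurd h2 hper.ne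
          · have hpos : 0 < cloudP1 e₁ e₂ (Finset.univ.erase j₀) (fun _ => (1 : ℝ)) (fun j => a j 0) (fun j => -(a j 1))
                (fun j => -(a j 2)) x₁ := by
              unfold cloudP1
              exact Finset.sum_pos (fun j hj => by rw [one_mul]; exact (hBG x₁ hI1 j hj).2.1) hs
            linarith
      · exact riser_turning_persist e₁ e₂ (a j₀ 0) (-(a j₀ 1)) (-(a j₀ 2)) (by linarith) (by linarith) h0 (h12.trans h23).le hsw
          hstart x ⟨h, hx.2⟩
    · -- unswitched coherent: `ψ₁(x₃) ≤ 0`, hence `ψ₁ < 0` on `[x₁, x₃)`; at `x₃` argue as for the riser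
      have h3v := hpos_of j₀ v (hu.trans_le hv) hunv
      have hun : ∀ t ∈ Set.Icc u v, 0 < a j₀ 0 - (-(a j₀ 1)) * t ^ (e₁ + 1) - (-(a j₀ 2)) * t ^ (e₁ + e₂ + 2) := fun t ht =>
        coherent_value_pos_of_le e₁ e₂ (a j₀ 0) (-(a j₀ 1)) (-(a j₀ 2)) hA.le (by linarith) (hx0 t ht) ht.2 h3v
      have hend := hψle x₃ (by simp) hI3
      rcases lt_or_eq_of_le hx.2 with h | h
      · exact coherent_rowPsi1_neg_of_lt e₁ e₂ (a j₀ 0) (-(a j₀ 1)) (-(a j₀ 2)) hA (by linarith) (by linarith) hx' h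
          (hun x hxI).ne' (hun x₃ hI3).ne' hend
      · subst h
        rcases lt_or_eq_of_le hend with hlt | heq
        · exact hlt
        · exfalso
          have hcl := hzero' x (by simp)
          rw [heq, zero_add] at hcl
          rcases (Finset.univ.erase j₀).eq_empty_or_nonempty with hs | hs
          · have h2 := hzero' x₂ (by simp)
            rw [hs] at h2
            simp only [cloudP1, Finset.sum_empty, add_zero] at h2
            have hI2 : x₂ ∈ Set.Icc u v := hI x₂ ⟨h12.le, h23.le⟩
            have hneg := coherent_rowPsi1_neg_of_lt e₁ e₂ (a j₀ 0) (-(a j₀ 1)) (-(a j₀ 2)) hA (by linarith) (by linarith)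
              (hx0 x₂ hI2) h23 (hun x₂ hI2).ne' (hun x hxI).ne' heq.le
            exact absurd h2 hneg.ne
          · have hpos : 0 < cloudP1 e₁ e₂ (Finset.univ.erase j₀) (fun _ => (1 : ℝ)) (fun j => a j 0) (fun j => -(a j 1))
                (fun j => -(a j 2)) x := by
              unfold cloudP1
              exact Finset.sum_pos (fun j hj => by rw [one_mul]; exact (hBG x hxI j hj).2.1) hs
            linarith
  -- with or without a background row
  rcases (Finset.univ.erase j₀).eq_empty_or_nonempty with hs | hs
  · have h1 := hzero' x₁ (by simp)
    rw [hs] at h1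
    simp only [cloudP1, Finset.sum_empty, add_zero] at h1
    exact absurd h1 (hpost x₁ ⟨le_rfl, (h12.trans h23).le⟩).ne
  · exact hump_backgroundCloud_no_three_zeros e₁ e₂ (a j₀ 0) (-(a j₀ 1)) (-(a j₀ 2)) (Finset.univ.erase j₀) hs (fun _ => (1 : ℝ))
      (fun j => a j 0) (fun j => -(a j 1)) (fun j => -(a j 2)) (fun _ _ => one_pos) h0 h12 h23
      (fun x hx => (hB0 x (hI x hx)).1) hpost (fun x hx => (hB0 x (hI x hx)).2) (fun x hx j hj => hBG x (hI x hx) j hj) hzero'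

end ProductPlusOne

end Summit.ValiantsHypothesis.ValiantsHypothesis.Theorems.LacunarySymmetroidMatrixDescartes
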